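import Mathlib
import Literature.NumberTheory.Transcendental.KZLogCalculusProofs
import Literature.NumberTheory.Transcendental.SemialgebraicMapsProofs

/-!
# `TateLifting` (stmt-KontsevichZagierPeriods-9129), line `Sketch` — honest pull-backs along a change of
# variables (infrastructure for the substitution stubs)

Kontsevich–Zagier's rule (2) (`KZ.changeOfVariablesRel`) relates two GIVEN representations `r'` (source)
and `r` (target) along a `ℚ`-semialgebraic, injective, differentiable map `Φ` with `Φ(D) = σ` and
`f' = (f ∘ Φ)·|det Φ'|` on `D`. In the line's substitution stubs (`tateLifting_sqrtSubst`, stub 33; the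
affine and Euler substitutions of the square-root sector) the source representation is not given but must
be CONSTRUCTED, and the three honesty obligations are always discharged the same way: the domain `D` is
semialgebraic (given), the integrand `J·(f ∘ Φ)` is semialgebraic on `D` as soon as a semialgebraic
function `J` agreeing with `|det Φ'|` on `D` is supplied (Tarski–Seidenberg composition
`IsSemialgebraicFunOn.comp_isSemialgebraicMapOn_holds` and products), and it is absolutely integrable on
`D` by Mathlib's Jacobian criterion `MeasureTheory.integrableOn_image_iff_integrableOn_abs_det_fderiv_smul`.
This file packages that once and for all, in every dimension: `tateLifting_pullback` — the honest
pulled-back representation `[D, J·(f ∘ Φ)]` exists and `[σ, f] − [D, J·(f ∘ Φ)] ∈ KZ.relations`.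

References: M. Kontsevich, D. Zagier, *Periods* (2001), §1.2 rule (2); J. Bochnak, M. Coste, M.-F. Roy,
*Real Algebraic Geometry* (1998), §2.2 (Tarski–Seidenberg).
-/

noncomputable section

open MeasureTheory Set
open Literature.NumberTheory.Transcendental
open Literature.ModelTheory.ExponentialFields (IsSemialgebraic)

namespace Summit.KontsevichZagierPeriods.InverseLandau

namespace Pullback

variable {n : ℕ}

/-- **The pulled-back integrand is semialgebraic**: for a `ℚ`-semialgebraic map `Φ` on `D` with
`Φ(D) ⊆ σ`, a `ℚ`-semialgebraic `f` on `σ` and a `ℚ`-semialgebraic `J` on `D`, the function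
`x ↦ J x · f (Φ x)` is `ℚ`-semialgebraic on `D` (Tarski–Seidenberg). [cite: BCR1998, §2.2] -/
theorem isSemialgebraicFunOn_mul_comp {D σ : Set (Fin n → ℝ)} {Φ : (Fin n → ℝ) → (Fin n → ℝ)}
    {f J : (Fin n → ℝ) → ℝ} (hΦ : IsSemialgebraicMapOn ℚ D Φ) (hmaps : MapsTo Φ D σ)
    (hf : IsSemialgebraicFunOn ℚ σ f) (hJ : IsSemialgebraicFunOn ℚ D J) :
    IsSemialgebraicFunOn ℚ D (fun x => J x * f (Φ x)) :=
  (IsSemialgebraicFunOn.mul_holds hJ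
    (IsSemialgebraicFunOn.comp_isSemialgebraicMapOn_holds hf hΦ hmaps)).congr fun _ _ => rfl

/-- **The pulled-back integrand is absolutely integrable** (Jacobian criterion): if `Φ` is injective on the
measurable set `D` with derivative `Φ' x` within `D` at every `x ∈ D`, `f` is integrable on `Φ(D)` and
`J = |det Φ'|` on `D`, then `x ↦ J x · f (Φ x)` is integrable on `D`. [folklore] -/
theorem integrableOn_mul_comp {D : Set (Fin n → ℝ)} (hDm : MeasurableSet D)
    {Φ : (Fin n → ℝ) → (Fin n → ℝ)} {Φ' : (Fin n → ℝ) → (Fin n → ℝ) →L[ℝ] (Fin n → ℝ)}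
    (hderiv : ∀ x ∈ D, HasFDerivWithinAt Φ (Φ' x) D x) (hinj : InjOn Φ D) {f J : (Fin n → ℝ) → ℝ}
    (hf : IntegrableOn f (Φ '' D)) (hJ : ∀ x ∈ D, J x = |(Φ' x).det|) :
    IntegrableOn (fun x => J x * f (Φ x)) D := by
  have h := (integrableOn_image_iff_integrableOn_abs_det_fderiv_smul volume hDm hderiv hinj f).1 hf
  refine h.congr_fun (fun x hx => ?_) hDm
  show |(Φ' x).det| • f (Φ x) = J x * f (Φ x)
  rw [hJ x hx, smul_eq_mul]

end Pullback

/-- **Honest pull-back along a change of variables** (rule (2) with a CONSTRUCTED source). Let `r = [σ, f]`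
be an integral representation of dimension `n`, `D ⊆ ℝⁿ` a `ℚ`-semialgebraic set, `Φ` a `ℚ`-semialgebraic
map on `D`, injective on `D`, with derivative `Φ' x` within `D` at every `x ∈ D`, and `Φ(D) = σ`; let `J`
be a `ℚ`-semialgebraic function on `D` with `J = |det Φ'|` there. Then the pulled-back representation
`r' = [D, J·(f ∘ Φ)]` EXISTS as an honest integral representation (domain `D`, integrand literally
`x ↦ J x · f (Φ x)`), and `[σ, f] − [D, J·(f ∘ Φ)] ∈ KZ.relations` — one change-of-variables move from
`r'` onto `r`. [cite: KontsevichZagier2001, §1.2 rule (2)] -/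
theorem tateLifting_pullback :
    ∀ (n : ℕ) (r : KZ.IntegralRep n) (D : Set (Fin n → ℝ)) (Φ : (Fin n → ℝ) → (Fin n → ℝ))
      (Φ' : (Fin n → ℝ) → (Fin n → ℝ) →L[ℝ] (Fin n → ℝ)) (J : (Fin n → ℝ) → ℝ),
      IsSemialgebraic ℚ D → IsSemialgebraicMapOn ℚ D Φ →
      (∀ x ∈ D, HasFDerivWithinAt Φ (Φ' x) D x) → Set.InjOn Φ D → Φ '' D = r.domain →
      IsSemialgebraicFunOn ℚ D J → (∀ x ∈ D, J x = |(Φ' x).det|) →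
      ∃ r' : KZ.IntegralRep n, r'.domain = D ∧ (r'.integrand = fun x => J x * r.integrand (Φ x)) ∧
        KZ.of r - KZ.of r' ∈ KZ.relations := by
  intro n r D Φ Φ' J hD hΦ hderiv hinj himage hJ hJdet
  have hmaps : MapsTo Φ D r.domain := fun x hx => himage ▸ mem_image_of_mem Φ hx
  have hint : IntegrableOn (fun x => J x * r.integrand (Φ x)) D :=
    Pullback.integrableOn_mul_comp (IsSemialgebraic.measurableSet_holds hD) hderiv hinj
      (by rw [himage]; exact r.integrableOn) hJdet
  refine ⟨⟨D, fun x => J x * r.integrand (Φ x), hD,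
    Pullback.isSemialgebraicFunOn_mul_comp hΦ hmaps r.isSemialgebraicFunOn_integrand hJ, hint⟩,
    rfl, rfl, ?_⟩
  -- ONE change of variables from `r'` onto `r`; `[r] − [r'] = −([r'] − [r])`
  rw [← neg_sub]
  refine KZ.relations.neg_mem (KZ.changeOfVariablesRel_subset_relations
    ⟨n, _, r, Φ, Φ', hΦ, hderiv, hinj, himage.symm, fun x hx => ?_, rfl⟩)
  show J x * r.integrand (Φ x) = r.integrand (Φ x) * |(Φ' x).det|
  rw [hJdet x hx, mul_comm]

/-- **Pull-back in dimension one along a scalar chart.** Specialisation of `tateLifting_pullback` to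
`ℝ¹` with `Φ y = (φ (y 0))` and `Φ' y = (φ' (y 0)) • id`: it suffices that `φ` be `ℚ`-semialgebraic as a
function on `D` (read on the coordinate), have derivative `φ' (y 0)` at `y 0` for `y ∈ D`, be injective
on `D`, map `D` onto `σ`, and that `J = |φ'|` on `D` be `ℚ`-semialgebraic.
[cite: KontsevichZagier2001, §1.2 rule (2)] -/
theorem tateLifting_pullback_dimOne (r : KZ.IntegralRep 1) (D : Set (Fin 1 → ℝ)) (φ φ' : ℝ → ℝ)
    (J : (Fin 1 → ℝ) → ℝ) (hD : IsSemialgebraic ℚ D)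
    (hφ : IsSemialgebraicFunOn ℚ D fun y => φ (y 0))
    (hderiv : ∀ y ∈ D, HasDerivAt φ (φ' (y 0)) (y 0))
    (hinj : Set.InjOn (fun y : Fin 1 → ℝ => fun _ : Fin 1 => φ (y 0)) D)
    (himage : (fun y : Fin 1 → ℝ => fun _ : Fin 1 => φ (y 0)) '' D = r.domain)
    (hJ : IsSemialgebraicFunOn ℚ D J) (hJdet : ∀ y ∈ D, J y = |φ' (y 0)|) :
    ∃ r' : KZ.IntegralRep 1, r'.domain = D ∧
      (r'.integrand = fun y => J y * r.integrand (fun _ => φ (y 0))) ∧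
      KZ.of r - KZ.of r' ∈ KZ.relations := by
  have hΦ : IsSemialgebraicMapOn ℚ D (fun y : Fin 1 → ℝ => fun _ : Fin 1 => φ (y 0)) :=
    IsSemialgebraicMapOn.of_forall hD fun _ => hφ
  have hΦ' : ∀ y ∈ D, HasFDerivWithinAt (fun y : Fin 1 → ℝ => fun _ : Fin 1 => φ (y 0))
      ((φ' (y 0)) • ContinuousLinearMap.id ℝ (Fin 1 → ℝ)) D y := by
    intro y hy
    refine HasFDerivAt.hasFDerivWithinAt ?_
    rw [hasFDerivAt_pi']
    intro i
    have h0 : HasFDerivAt (fun f : Fin 1 → ℝ => f 0)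
        (ContinuousLinearMap.proj (R := ℝ) (φ := fun _ : Fin 1 => ℝ) 0) y :=
      hasFDerivAt_apply 0 y
    refine ((hderiv y hy).comp_hasFDerivAt y h0).congr_fderiv (ContinuousLinearMap.ext fun v => ?_)
    obtain rfl : i = 0 := Fin.fin_one_eq_zero i
    simp
  have hdet : ∀ y ∈ D, J y = |(((φ' (y 0)) • ContinuousLinearMap.id ℝ (Fin 1 → ℝ))).det| := by
    intro y hy
    rw [hJdet y hy]
    congr 1
    rw [show ((φ' (y 0)) • ContinuousLinearMap.id ℝ (Fin 1 → ℝ)).det =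
      LinearMap.det ((φ' (y 0)) • (LinearMap.id : (Fin 1 → ℝ) →ₗ[ℝ] (Fin 1 → ℝ))) from rfl,
      LinearMap.det_smul, LinearMap.det_id]
    simp
  exact tateLifting_pullback 1 r D _ _ J hD hΦ hΦ' hinj himage hJ hdet

end Summit.KontsevichZagierPeriods.InverseLandau

end
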